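import Literature.NumberTheory.ModularForms.ModularFormPeriodicTwist
import Mathlib.NumberTheory.LegendreSymbol.JacobiSymbol
import Mathlib.RingTheory.PowerSeries.Basic
import Mathlib.Algebra.Ring.Periodic
import Mathlib.Data.Nat.Periodic
import HarnessLib

/-!
# Crux `PrintCFram.BottomClassIndexLawFiveLe` (stmt-BirchSwinnertonDyer-20372), line `eisenstein-resource-bdp-line`
# (registry v23): the index set of `stub_cutForm` is PERIODIC, and the cut commutes with `Q`-supported factors
# (cell `bsd-print-cfram`, width seat `bsd-line-cfram-p1-w3` g12; THEOREMS ONLY, `--supports` 20372; BSD is not proved by any of this)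

HONEST FRAMING. Nothing here is a statement about BSD; no registered stub is closed. Registry v23's `stub_cutForm`
(= the `hcut` binder of `ThetaCycle.atP_six_of_cutForm`, p686877) asks for the `m`-cut Cohen–Eisenstein series mod `p`
inside a Katz family. Its typing (crux notes `Lines/eisenstein-resource-bdp-line-w8g6-notes.md` §3.2) factors through
four named facts NF-A … NF-D; NF-C is «cutting the `q`-expansion of an integral-weight modular form on `Γ₁(L)` along a
set of residues mod `Q` gives a modular form on `Γ₁(L Q²)`», now a KERNEL theorem
(`Literature.NumberTheory.ModularForms.PeriodicTwist.exists_modularForm_gamma1_qExpansion_coeff_eq_mul`). This file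
supplies the two elementary facts that plug NF-C into (CutForm⁶):

* `cutIndex_add_iff` / `cutIndex_iff_mod` — the index predicate of `hcut`,
  `CUT(m,r,e)(a) :⇔ m ∣ a ∧ a/m ≡ 3 (4) ∧ (∀ odd primes q ∣ m, J(−a/m | q) = 1) ∧ (2 ∣ m → a/m ≡ 7 (8)) ∧ rᵉ ∥ a/m`,
  is PERIODIC in `a` with period `Q₀ = 8·m²·r^(e+1)` (so it is a set of residues mod `Q₀`, and `p ∤ Q₀` for `p ∤ 2mr`);
  `cuspCutIndex_add_iff` — the same for the (3,0)-cut of registry v24's `stub_cuspCutForm` (the `hcut` binder of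
  `CuspSeed.cuspSeed_six_of_cutForm`, p688228: `… ∧ ¬ 3 ∣ a/m` in place of `rᵉ ∥ a/m`), period `Q₁ = 24·m²`;
* `PowerSeries.coeff_mul_eq_mul_coeff_mul_of_periodic` — multiplying coefficientwise by a `Q`-periodic function
  commutes with multiplication by a power series supported on exponents `≡ 0 (mod Q)` (so the cut of `H_k · θ₀(Q²z)^p` is
  `cut(H_k) · θ₀(Q²z)^p`, w8 g6 memo §3.2 first sentence), and its support corollary `coeff_mul_of_periodic_support`;
* `exists_modularForm_gamma1_qExpansion_cut` / `exists_modularForm_gamma1_qExpansion_cuspCut` — NF-C SPECIALISED to the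
  two registered cut index sets: for every `F : ModularForm (Gamma1 L) κ` there is `F' : ModularForm (Gamma1 (L·Q₀²)) κ`
  (resp. `(L·Q₁²)`) whose `qExpansion 1` agrees with that of `F` on the cut and vanishes off it.

No definitions, no named facts, no `sorry`. beyond-print theorem: NO (Shimura 1971 Prop. 3.64 / Koblitz III §3 Prop. 17
bookkeeping).
-/

set_option autoImplicit false
-- summit-side namespace `Summit.BirchSwinnertonDyer.BirchSwinnertonDyer.…` (single-conjunct summit, D-0017 layout)
set_option linter.dupNamespace false

open scoped NumberTheorySymbols

namespace Summit.BirchSwinnertonDyer.BirchSwinnertonDyer.Theorems.PrintCFram.CutForm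

/-! ## §1 Periodicity of the cut index predicate -/

/-- The residue conditions of the cut on `n' = a/m` are invariant under `n' ↦ n' + D` whenever `8 ∣ D`, every odd prime
`q ∣ m` divides `D`, and `r^(e+1) ∣ D`. -/
theorem cutResidue_add_iff (m r e n D : ℕ) (h8 : 8 ∣ D) (hq : ∀ q : ℕ, q.Prime → q ∣ m → q ∣ D)
    (hr : r ^ (e + 1) ∣ D) :
    ((n + D) % 4 = 3 ∧ (∀ q : ℕ, q.Prime → q ∣ m → q ≠ 2 → jacobiSym (-(((n + D : ℕ)) : ℤ)) q = 1) ∧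
        (2 ∣ m → (n + D) % 8 = 7) ∧ r ^ e ∣ n + D ∧ ¬ r ^ (e + 1) ∣ n + D) ↔
      (n % 4 = 3 ∧ (∀ q : ℕ, q.Prime → q ∣ m → q ≠ 2 → jacobiSym (-((n : ℕ) : ℤ)) q = 1) ∧
        (2 ∣ m → n % 8 = 7) ∧ r ^ e ∣ n ∧ ¬ r ^ (e + 1) ∣ n) := by
  obtain ⟨D8, rfl⟩ := h8
  have h4 : (n + 8 * D8) % 4 = n % 4 := by
    rw [show n + 8 * D8 = n + 4 * (2 * D8) by ring, Nat.add_mul_mod_self_left]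
  have h8' : (n + 8 * D8) % 8 = n % 8 := by
    rw [Nat.add_mul_mod_self_left]
  have hre : r ^ e ∣ 8 * D8 := (pow_dvd_pow r (Nat.le_succ e)).trans hr
  have hJ : ∀ q : ℕ, q.Prime → q ∣ m →
      jacobiSym (-(((n + 8 * D8 : ℕ)) : ℤ)) q = jacobiSym (-((n : ℕ) : ℤ)) q := by
    intro q hqp hqm
    obtain ⟨D', hD'⟩ := hq q hqp hqm
    rw [jacobiSym.mod_left, jacobiSym.mod_left (-((n : ℕ) : ℤ)) q]
    congr 1
    rw [hD']
    push_cast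
    rw [show -((n : ℤ) + (q : ℤ) * D') = -(n : ℤ) + (q : ℤ) * (-(D' : ℤ)) by ring,
      Int.add_mul_emod_self_left]
  rw [h4, h8', Nat.dvd_add_left hre, Nat.dvd_add_left hr]
  constructor
  · rintro ⟨h1, h2, h3, h5, h6⟩
    exact ⟨h1, fun q hqp hqm hq2 ↦ (hJ q hqp hqm) ▸ h2 q hqp hqm hq2, h3, h5, h6⟩
  · rintro ⟨h1, h2, h3, h5, h6⟩
    exact ⟨h1, fun q hqp hqm hq2 ↦ (hJ q hqp hqm).symm ▸ h2 q hqp hqm hq2, h3, h5, h6⟩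

/-- **The cut index predicate of `stub_cutForm` is periodic with period `Q₀ = 8·m²·r^(e+1)`**: for every `t`,
`CUT(m,r,e)(a + Q₀ t) ↔ CUT(m,r,e)(a)`, where `CUT(m,r,e)(a)` is the support condition of the `hcut` binder of
`ThetaCycle.atP_six_of_cutForm` verbatim. -/
theorem cutIndex_add_iff (m r e a t : ℕ) (hm : 0 < m) :
    (m ∣ a + 8 * m ^ 2 * r ^ (e + 1) * t ∧ (a + 8 * m ^ 2 * r ^ (e + 1) * t) / m % 4 = 3 ∧
        (∀ q : ℕ, q.Prime → q ∣ m → q ≠ 2 →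
          jacobiSym (-(((a + 8 * m ^ 2 * r ^ (e + 1) * t) / m : ℕ) : ℤ)) q = 1) ∧
        (2 ∣ m → (a + 8 * m ^ 2 * r ^ (e + 1) * t) / m % 8 = 7) ∧
        r ^ e ∣ (a + 8 * m ^ 2 * r ^ (e + 1) * t) / m ∧ ¬ r ^ (e + 1) ∣ (a + 8 * m ^ 2 * r ^ (e + 1) * t) / m) ↔
      (m ∣ a ∧ a / m % 4 = 3 ∧ (∀ q : ℕ, q.Prime → q ∣ m → q ≠ 2 → jacobiSym (-((a / m : ℕ) : ℤ)) q = 1) ∧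
        (2 ∣ m → a / m % 8 = 7) ∧ r ^ e ∣ a / m ∧ ¬ r ^ (e + 1) ∣ a / m) := by
  set D : ℕ := 8 * m * r ^ (e + 1) * t with hD
  have hQ : 8 * m ^ 2 * r ^ (e + 1) * t = m * D := by rw [hD]; ring
  have hdiv : (a + 8 * m ^ 2 * r ^ (e + 1) * t) / m = a / m + D := by
    rw [hQ, Nat.add_mul_div_left _ _ hm]
  have hdvd : m ∣ a + 8 * m ^ 2 * r ^ (e + 1) * t ↔ m ∣ a := by
    rw [hQ]
    exact Nat.dvd_add_left (dvd_mul_right m D)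
  have h8 : 8 ∣ D := ⟨m * r ^ (e + 1) * t, by rw [hD]; ring⟩
  have hq : ∀ q : ℕ, q.Prime → q ∣ m → q ∣ D := fun q _ hqm ↦
    hqm.trans ⟨8 * r ^ (e + 1) * t, by rw [hD]; ring⟩
  have hr : r ^ (e + 1) ∣ D := ⟨8 * m * t, by rw [hD]; ring⟩
  rw [hdiv, hdvd, cutResidue_add_iff m r e (a / m) D h8 hq hr]

/-- The cut index predicate depends only on `a mod Q₀`, `Q₀ = 8·m²·r^(e+1)`: `CUT(a) ↔ CUT(a mod Q₀)`. -/
theorem cutIndex_iff_mod (m r e a : ℕ) (hm : 0 < m) :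
    (m ∣ a ∧ a / m % 4 = 3 ∧ (∀ q : ℕ, q.Prime → q ∣ m → q ≠ 2 → jacobiSym (-((a / m : ℕ) : ℤ)) q = 1) ∧
        (2 ∣ m → a / m % 8 = 7) ∧ r ^ e ∣ a / m ∧ ¬ r ^ (e + 1) ∣ a / m) ↔
      (m ∣ a % (8 * m ^ 2 * r ^ (e + 1)) ∧ a % (8 * m ^ 2 * r ^ (e + 1)) / m % 4 = 3 ∧
        (∀ q : ℕ, q.Prime → q ∣ m → q ≠ 2 →
          jacobiSym (-((a % (8 * m ^ 2 * r ^ (e + 1)) / m : ℕ) : ℤ)) q = 1) ∧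
        (2 ∣ m → a % (8 * m ^ 2 * r ^ (e + 1)) / m % 8 = 7) ∧
        r ^ e ∣ a % (8 * m ^ 2 * r ^ (e + 1)) / m ∧ ¬ r ^ (e + 1) ∣ a % (8 * m ^ 2 * r ^ (e + 1)) / m) := by
  conv_lhs => rw [← Nat.mod_add_div a (8 * m ^ 2 * r ^ (e + 1))]
  exact cutIndex_add_iff m r e (a % (8 * m ^ 2 * r ^ (e + 1))) (a / (8 * m ^ 2 * r ^ (e + 1))) hm

/-- The residue conditions of the (3,0)-cut on `n' = a/m` (registry v24 `stub_cuspCutForm`) are invariant under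
`n' ↦ n' + D` whenever `8 ∣ D`, every prime `q ∣ m` divides `D`, and `3 ∣ D`. -/
theorem cuspCutResidue_add_iff (m n D : ℕ) (h8 : 8 ∣ D) (hq : ∀ q : ℕ, q.Prime → q ∣ m → q ∣ D) (h3 : 3 ∣ D) :
    ((n + D) % 4 = 3 ∧ (∀ q : ℕ, q.Prime → q ∣ m → q ≠ 2 → jacobiSym (-(((n + D : ℕ)) : ℤ)) q = 1) ∧
        (2 ∣ m → (n + D) % 8 = 7) ∧ ¬ 3 ∣ n + D) ↔
      (n % 4 = 3 ∧ (∀ q : ℕ, q.Prime → q ∣ m → q ≠ 2 → jacobiSym (-((n : ℕ) : ℤ)) q = 1) ∧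
        (2 ∣ m → n % 8 = 7) ∧ ¬ 3 ∣ n) := by
  obtain ⟨D8, rfl⟩ := h8
  have h4 : (n + 8 * D8) % 4 = n % 4 := by
    rw [show n + 8 * D8 = n + 4 * (2 * D8) by ring, Nat.add_mul_mod_self_left]
  have h8' : (n + 8 * D8) % 8 = n % 8 := by
    rw [Nat.add_mul_mod_self_left]
  have hJ : ∀ q : ℕ, q.Prime → q ∣ m →
      jacobiSym (-(((n + 8 * D8 : ℕ)) : ℤ)) q = jacobiSym (-((n : ℕ) : ℤ)) q := by
    intro q hqp hqm
    obtain ⟨D', hD'⟩ := hq q hqp hqm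
    rw [jacobiSym.mod_left, jacobiSym.mod_left (-((n : ℕ) : ℤ)) q]
    congr 1
    rw [hD']
    push_cast
    rw [show -((n : ℤ) + (q : ℤ) * D') = -(n : ℤ) + (q : ℤ) * (-(D' : ℤ)) by ring,
      Int.add_mul_emod_self_left]
  rw [h4, h8', Nat.dvd_add_left h3]
  constructor
  · rintro ⟨h1, h2, h5, h6⟩
    exact ⟨h1, fun q hqp hqm hq2 ↦ (hJ q hqp hqm) ▸ h2 q hqp hqm hq2, h5, h6⟩
  · rintro ⟨h1, h2, h5, h6⟩
    exact ⟨h1, fun q hqp hqm hq2 ↦ (hJ q hqp hqm).symm ▸ h2 q hqp hqm hq2, h5, h6⟩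

/-- **The (3,0)-cut index predicate of `stub_cuspCutForm` is periodic with period `Q₁ = 24·m²`**: for every `t`,
`CUT'(m)(a + Q₁ t) ↔ CUT'(m)(a)`, where `CUT'(m)(a)` is the support condition of the `hcut` binder of
`CuspSeed.cuspSeed_six_of_cutForm` verbatim. -/
theorem cuspCutIndex_add_iff (m a t : ℕ) (hm : 0 < m) :
    (m ∣ a + 24 * m ^ 2 * t ∧ (a + 24 * m ^ 2 * t) / m % 4 = 3 ∧
        (∀ q : ℕ, q.Prime → q ∣ m → q ≠ 2 → jacobiSym (-(((a + 24 * m ^ 2 * t) / m : ℕ) : ℤ)) q = 1) ∧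
        (2 ∣ m → (a + 24 * m ^ 2 * t) / m % 8 = 7) ∧ ¬ 3 ∣ (a + 24 * m ^ 2 * t) / m) ↔
      (m ∣ a ∧ a / m % 4 = 3 ∧ (∀ q : ℕ, q.Prime → q ∣ m → q ≠ 2 → jacobiSym (-((a / m : ℕ) : ℤ)) q = 1) ∧
        (2 ∣ m → a / m % 8 = 7) ∧ ¬ 3 ∣ a / m) := by
  set D : ℕ := 24 * m * t with hD
  have hQ : 24 * m ^ 2 * t = m * D := by rw [hD]; ring
  have hdiv : (a + 24 * m ^ 2 * t) / m = a / m + D := by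
    rw [hQ, Nat.add_mul_div_left _ _ hm]
  have hdvd : m ∣ a + 24 * m ^ 2 * t ↔ m ∣ a := by
    rw [hQ]
    exact Nat.dvd_add_left (dvd_mul_right m D)
  have h8 : 8 ∣ D := ⟨3 * m * t, by rw [hD]; ring⟩
  have hq : ∀ q : ℕ, q.Prime → q ∣ m → q ∣ D := fun q _ hqm ↦
    hqm.trans ⟨24 * t, by rw [hD]; ring⟩
  have h3 : 3 ∣ D := ⟨8 * m * t, by rw [hD]; ring⟩
  rw [hdiv, hdvd, cuspCutResidue_add_iff m (a / m) D h8 hq h3]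

/-! ## §2 The cut commutes with `Q`-supported factors -/

/-- **Coefficientwise multiplication by a `Q`-periodic function commutes with multiplication by a power series
supported on exponents divisible by `Q`**: if `ψ = ∑ c(n) φₙ Xⁿ` with `c` periodic of period `Q` and `T` is supported on
`Q ℕ`, then `ψ·T = ∑ c(n) (φ·T)ₙ Xⁿ`. (Applied with `c = 𝟙_CUT`, `Q = Q₀`, `T = θ₀(Q₀² z)^p`: the cut of `H_k·T` is
`cut(H_k)·T`.) -/
theorem _root_.PowerSeries.coeff_mul_eq_mul_coeff_mul_of_periodic {R : Type*} [CommSemiring R] {Q : ℕ}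
    {c : ℕ → R} (hc : Function.Periodic c Q) {φ ψ T : PowerSeries R}
    (hψ : ∀ n : ℕ, PowerSeries.coeff n ψ = c n * PowerSeries.coeff n φ)
    (hT : ∀ j : ℕ, PowerSeries.coeff j T ≠ 0 → Q ∣ j) (n : ℕ) :
    PowerSeries.coeff n (ψ * T) = c n * PowerSeries.coeff n (φ * T) := by
  rw [PowerSeries.coeff_mul, PowerSeries.coeff_mul, Finset.mul_sum]
  refine Finset.sum_congr rfl fun ij hij ↦ ?_
  rw [Finset.mem_antidiagonal] at hij
  by_cases h0 : PowerSeries.coeff ij.2 T = 0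
  · simp [h0]
  · obtain ⟨s, hs⟩ := hT _ h0
    have hcn : c ij.1 = c n := by
      rw [← hij, hs, mul_comm Q s]
      exact ((hc.nat_mul s) ij.1).symm
    rw [hψ, hcn, mul_assoc]

/-- Support corollary: if `ψ` agrees with `φ` on a `Q`-periodic index set `S` and vanishes off `S`, and `T` is supported on
`Q ℕ`, then `ψ·T` agrees with `φ·T` on `S` and vanishes off `S`. -/
theorem _root_.PowerSeries.coeff_mul_of_periodic_support {R : Type*} [CommSemiring R] {Q : ℕ} {S : ℕ → Prop}
    (hS : Function.Periodic S Q) {φ ψ T : PowerSeries R}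
    (hon : ∀ n : ℕ, S n → PowerSeries.coeff n ψ = PowerSeries.coeff n φ)
    (hoff : ∀ n : ℕ, ¬ S n → PowerSeries.coeff n ψ = 0)
    (hT : ∀ j : ℕ, PowerSeries.coeff j T ≠ 0 → Q ∣ j) (n : ℕ) :
    (S n → PowerSeries.coeff n (ψ * T) = PowerSeries.coeff n (φ * T)) ∧
      (¬ S n → PowerSeries.coeff n (ψ * T) = 0) := by
  classical
  have hc : Function.Periodic (fun n ↦ if S n then (1 : R) else 0) Q := fun x ↦ by
    simp only [hS x]
  have hψ : ∀ n : ℕ, PowerSeries.coeff n ψ = (if S n then (1 : R) else 0) * PowerSeries.coeff n φ := by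
    intro n
    by_cases h : S n
    · simp [h, hon n h]
    · simp [h, hoff n h]
  have key := PowerSeries.coeff_mul_eq_mul_coeff_mul_of_periodic hc hψ hT n
  constructor
  · intro h; simpa [h] using key
  · intro h; simpa [h] using key

/-! ## §3 NF-C for the cut index set: the cut of a modular form on `Γ₁(L)` is a modular form on `Γ₁(L·Q₀²)` -/

/-- **NF-C of the typing memo, DISCHARGED for the cut index set of `stub_cutForm`.** For every modular form `F` of
integral weight `κ` on `Γ₁(L)` and every `m ≥ 1`, `r ≥ 1`, `e`, there is a modular form `F'` of weight `κ` on
`Γ₁(L·Q₀²)`, `Q₀ = 8·m²·r^(e+1)`, whose `q`-expansion (Mathlib `qExpansion 1`) is that of `F` restricted to the cut index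
set CUT(m,r,e) of the `hcut` binder of `ThetaCycle.atP_six_of_cutForm` (agrees with `F` on CUT, vanishes off CUT) —
Shimura 1971 Prop. 3.64 / Koblitz III §3 Prop. 17 with the multiplier `𝟙_CUT`
(`Literature.NumberTheory.ModularForms.PeriodicTwist.exists_modularForm_gamma1_qExpansion_coeff_eq_mul_of_periodic`)
and §1 (CUT is `Q₀`-periodic). Nothing about BSD; no registered stub is closed. -/
theorem exists_modularForm_gamma1_qExpansion_cut {L : ℕ} [NeZero L] {κ : ℤ}
    (F : ModularForm (CongruenceSubgroup.Gamma1 L) κ) (m r e : ℕ) (hm : 0 < m) (hr : 0 < r) :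
    ∃ F' : ModularForm (CongruenceSubgroup.Gamma1 (L * (8 * m ^ 2 * r ^ (e + 1)) ^ 2)) κ,
      (∀ a : ℕ, (m ∣ a ∧ a / m % 4 = 3 ∧
          (∀ q : ℕ, q.Prime → q ∣ m → q ≠ 2 → jacobiSym (-((a / m : ℕ) : ℤ)) q = 1) ∧
          (2 ∣ m → a / m % 8 = 7) ∧ r ^ e ∣ a / m ∧ ¬ r ^ (e + 1) ∣ a / m) →
        PowerSeries.coeff a (UpperHalfPlane.qExpansion 1 F') = PowerSeries.coeff a (UpperHalfPlane.qExpansion 1 F)) ∧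
      (∀ a : ℕ, ¬ (m ∣ a ∧ a / m % 4 = 3 ∧
          (∀ q : ℕ, q.Prime → q ∣ m → q ≠ 2 → jacobiSym (-((a / m : ℕ) : ℤ)) q = 1) ∧
          (2 ∣ m → a / m % 8 = 7) ∧ r ^ e ∣ a / m ∧ ¬ r ^ (e + 1) ∣ a / m) →
        PowerSeries.coeff a (UpperHalfPlane.qExpansion 1 F') = 0) := by
  classical
  haveI : NeZero (8 * m ^ 2 * r ^ (e + 1)) := ⟨by positivity⟩
  let c : ℕ → ℂ := fun a ↦ if (m ∣ a ∧ a / m % 4 = 3 ∧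
      (∀ q : ℕ, q.Prime → q ∣ m → q ≠ 2 → jacobiSym (-((a / m : ℕ) : ℤ)) q = 1) ∧
      (2 ∣ m → a / m % 8 = 7) ∧ r ^ e ∣ a / m ∧ ¬ r ^ (e + 1) ∣ a / m) then 1 else 0
  have hc : Function.Periodic c (8 * m ^ 2 * r ^ (e + 1)) := fun a ↦ by
    have h := cutIndex_add_iff m r e a 1 hm
    rw [mul_one] at h
    simp only [c, h]
  obtain ⟨F', hF'⟩ :=
    Literature.NumberTheory.ModularForms.PeriodicTwist.exists_modularForm_gamma1_qExpansion_coeff_eq_mul_of_periodic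
      F hc
  refine ⟨F', fun a ha ↦ ?_, fun a ha ↦ ?_⟩
  · rw [hF' a]; simp only [c, if_pos ha, one_mul]
  · rw [hF' a]; simp only [c, if_neg ha, zero_mul]

/-- **NF-C for the (3,0)-cut of `stub_cuspCutForm`.** For every modular form `F` of integral weight `κ` on `Γ₁(L)` and
every `m ≥ 1` there is a modular form `F'` of weight `κ` on `Γ₁(L·Q₁²)`, `Q₁ = 24·m²`, whose `q`-expansion is that of
`F` restricted to the (3,0)-cut index set of the `hcut` binder of `CuspSeed.cuspSeed_six_of_cutForm` (agrees with `F`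
on the cut, vanishes off it). Nothing about the cusp constant of `F'` (the third conjunct of (CuspCutForm⁶)) is
claimed here. Nothing about BSD; no registered stub is closed. -/
theorem exists_modularForm_gamma1_qExpansion_cuspCut {L : ℕ} [NeZero L] {κ : ℤ}
    (F : ModularForm (CongruenceSubgroup.Gamma1 L) κ) (m : ℕ) (hm : 0 < m) :
    ∃ F' : ModularForm (CongruenceSubgroup.Gamma1 (L * (24 * m ^ 2) ^ 2)) κ,
      (∀ a : ℕ, (m ∣ a ∧ a / m % 4 = 3 ∧
          (∀ q : ℕ, q.Prime → q ∣ m → q ≠ 2 → jacobiSym (-((a / m : ℕ) : ℤ)) q = 1) ∧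
          (2 ∣ m → a / m % 8 = 7) ∧ ¬ 3 ∣ a / m) →
        PowerSeries.coeff a (UpperHalfPlane.qExpansion 1 F') = PowerSeries.coeff a (UpperHalfPlane.qExpansion 1 F)) ∧
      (∀ a : ℕ, ¬ (m ∣ a ∧ a / m % 4 = 3 ∧
          (∀ q : ℕ, q.Prime → q ∣ m → q ≠ 2 → jacobiSym (-((a / m : ℕ) : ℤ)) q = 1) ∧
          (2 ∣ m → a / m % 8 = 7) ∧ ¬ 3 ∣ a / m) →
        PowerSeries.coeff a (UpperHalfPlane.qExpansion 1 F') = 0) := by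
  classical
  haveI : NeZero (24 * m ^ 2) := ⟨by positivity⟩
  let c : ℕ → ℂ := fun a ↦ if (m ∣ a ∧ a / m % 4 = 3 ∧
      (∀ q : ℕ, q.Prime → q ∣ m → q ≠ 2 → jacobiSym (-((a / m : ℕ) : ℤ)) q = 1) ∧
      (2 ∣ m → a / m % 8 = 7) ∧ ¬ 3 ∣ a / m) then 1 else 0
  have hc : Function.Periodic c (24 * m ^ 2) := fun a ↦ by
    have h := cuspCutIndex_add_iff m a 1 hm
    rw [mul_one] at h
    simp only [c, h]
  obtain ⟨F', hF'⟩ :=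
    Literature.NumberTheory.ModularForms.PeriodicTwist.exists_modularForm_gamma1_qExpansion_coeff_eq_mul_of_periodic
      F hc
  refine ⟨F', fun a ha ↦ ?_, fun a ha ↦ ?_⟩
  · rw [hF' a]; simp only [c, if_pos ha, one_mul]
  · rw [hF' a]; simp only [c, if_neg ha, zero_mul]

end Summit.BirchSwinnertonDyer.BirchSwinnertonDyer.Theorems.PrintCFram.CutForm
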